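import Summits.Ventures.YMGap.Thresholds.OneLinkRecentredWords
import HarnessLib

/-!
# Venture YMGap — the one-link modulus beyond first order, part 58b: the RECENTRED cubic remainder, II — the pointwise gradient bound
# `Γ(ĉ₃′, ĉ₃′) ≤ P̂′²` (third foundation file of the mean-field recentring lever,
# cell notes `HOME/p2/ONE-LINK-HIERARCHY.md` §16 (α), `HOME/p2/hier/LEAN-SPEC-RECENTRING.md` F2)

HONEST FRAMING: venture file of the cell `pub-ymgap` (QuantumFields programme), strong-coupling LATTICE bookkeeping for `SU(N)`
lattice Yang–Mills; nothing about the continuum or the mass gap in the Clay sense.  Pure matrix calculus, no measure, no number of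
record.  WHAT.  The tree's non-linear cubic remainder `c₃′` (`OneLinkRemainderPrime`) carries the linear statistics `z_B = tr(gB)`,
`z_Δ = tr(gΔ)` in its `η`-slots (`η(z) = κ_t z − conj z/(4N)`) and in the weight factor `Im z_B`.  RECENTRING replaces them by the
fluctuations `z_B − m₁`, `z_Δ − m₂` for arbitrary complex constants `m₁, m₂` (in the application the means under `ν_B`; the mean part is
absorbed by `OneLinkRecentredPoisson.Lap_deltaPsi`).  This file assembles the shifted term lemmas of `OneLinkRecentredWords` exactly as `OneLinkRemainderPrime` assembles the unshifted ones
(the recentred SPLIT identity — the engine's `hdec` — is the next file `OneLinkRecentredSplit`):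
* `abs_matD_c3hat_le`, ★ `Gam_c3hat_le`: `Γ(ĉ₃′)(g) ≤ P̂′(g)²`, `P̂′` = the tree's `P′` with the shifted slots — so that after integration
  the `Z`-scales `‖z_j‖_{L²(ν)}` of the level-two assembly become the FLUCTUATION scales `‖z_j − m_j‖_{L²(ν)}` (Bakry–Émery: `≤ ‖M_j‖_F/√ρ`).
References: cell notes above.
-/

noncomputable section

open scoped Matrix ComplexConjugate BigOperators
open Matrix Complex Finset
open Literature.MathematicalPhysics.QuantumFieldTheory
open Literature.MathematicalPhysics.QuantumFieldTheory.SUNBakryEmery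

namespace Summit.Ventures.YMGap.OneLinkEigen

variable {N : ℕ}

section Calc

open scoped Matrix.Norms.Frobenius ContDiff Topology

/-! ### The recentred cubic remainder -/

/-- **`|D_A ĉ₃'(g)| ≤ P̂'(g) ‖A‖_F`** on `SU(N)`, `N ≥ 3`, for the RECENTRED five-term non-linear part `ĉ₃'` of the cubic remainder
(the tree's `c₃'` with `tr(gB) ↦ tr(gB) − m₁`, `tr(gΔ) ↦ tr(gΔ) − m₂` in the `η`/`Im`-slots; `P̂'` = the tree's `P'` with the same shifts). [folklore] -/
theorem abs_matD_c3hat_le (hN : 3 ≤ N) (B Δ A : Matrix (Fin N) (Fin N) ℂ) (m₁ m₂ : ℂ) (g : SUN N) :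
    |matD A (fun Q : Matrix (Fin N) (Fin N) ℂ =>
      ((N : ℝ) ^ 2 / (4 * ((N : ℝ) ^ 2 - 4))) / 2 *
          ((Q * B * Q * Δ * Q * B).trace.re + (Q * B * Q * B * Q * Δ).trace.re)
        + 2 * ((N : ℝ) ^ 2 / (4 * ((N : ℝ) ^ 2 - 4))) / N * ((Q * B).trace - m₁).im * (Q * Δ * Q * B).trace.im
        - 1 / 2 * ((Q * B * Q * B).trace *
            ((((N : ℝ) / (2 * ((N : ℝ) ^ 2 - 4)) : ℝ) : ℂ) * ((Q * Δ).trace - m₂)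
              - ((1 / (4 * (N : ℝ)) : ℝ) : ℂ) * (starRingEnd ℂ) ((Q * Δ).trace - m₂))).re
        - 1 / 2 * ((Q * Δ * Q * B).trace *
            ((((N : ℝ) / (2 * ((N : ℝ) ^ 2 - 4)) : ℝ) : ℂ) * ((Q * B).trace - m₁)
              - ((1 / (4 * (N : ℝ)) : ℝ) : ℂ) * (starRingEnd ℂ) ((Q * B).trace - m₁))).re
        - 2 * ((N : ℝ) / (2 * ((N : ℝ) ^ 2 - 4))) / N *
          ((Q * B).trace - m₁).im * ((Q * B).trace * (Q * Δ).trace).im) g| ≤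
      (3 * ((N : ℝ) ^ 2 / (4 * ((N : ℝ) ^ 2 - 4))) * matrixOpNorm B ^ 2 * frobNorm Δ
        + 2 * ((N : ℝ) ^ 2 / (4 * ((N : ℝ) ^ 2 - 4))) / N *
          (2 * matrixOpNorm B * frobNorm Δ * |(((g : Matrix (Fin N) (Fin N) ℂ) * B).trace - m₁).im|
            + frobNorm B * ‖((g : Matrix (Fin N) (Fin N) ℂ) * Δ * g * B).trace‖)
        + 1 / 2 * (((N : ℝ) / (2 * ((N : ℝ) ^ 2 - 4))) + 1 / (4 * (N : ℝ))) *
          (2 * matrixOpNorm B * frobNorm B * ‖((g : Matrix (Fin N) (Fin N) ℂ) * Δ).trace - m₂‖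
            + frobNorm Δ * ‖((g : Matrix (Fin N) (Fin N) ℂ) * B * g * B).trace‖)
        + 1 / 2 * (((N : ℝ) / (2 * ((N : ℝ) ^ 2 - 4))) + 1 / (4 * (N : ℝ))) *
          (2 * matrixOpNorm B * frobNorm Δ * ‖((g : Matrix (Fin N) (Fin N) ℂ) * B).trace - m₁‖
            + frobNorm B * ‖((g : Matrix (Fin N) (Fin N) ℂ) * Δ * g * B).trace‖)
        + 2 * ((N : ℝ) / (2 * ((N : ℝ) ^ 2 - 4))) / N *
          (frobNorm B * |(((g : Matrix (Fin N) (Fin N) ℂ) * B).trace - m₁).im| * ‖((g : Matrix (Fin N) (Fin N) ℂ) * Δ).trace‖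
            + frobNorm Δ * |(((g : Matrix (Fin N) (Fin N) ℂ) * B).trace - m₁).im| * ‖((g : Matrix (Fin N) (Fin N) ℂ) * B).trace‖
            + frobNorm B * ‖((g : Matrix (Fin N) (Fin N) ℂ) * B).trace‖ * ‖((g : Matrix (Fin N) (Fin N) ℂ) * Δ).trace‖))
        * frobNorm A := by
  have hN0 : N ≠ 0 := by omega
  have h3 : (3 : ℝ) ≤ N := by exact_mod_cast hN
  have hN4 : (0 : ℝ) < (N : ℝ) ^ 2 - 4 := by nlinarith
  have hNpos : (0 : ℝ) < N := by linarith
  set κw : ℝ := (N : ℝ) ^ 2 / (4 * ((N : ℝ) ^ 2 - 4)) with hκw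
  set κt : ℝ := (N : ℝ) / (2 * ((N : ℝ) ^ 2 - 4)) with hκt
  set c : ℝ := 1 / (4 * (N : ℝ)) with hc
  have hκw0 : 0 ≤ κw := by positivity
  have hκt0 : 0 ≤ κt := by positivity
  have hc0 : 0 ≤ c := by positivity
  set Q : Matrix (Fin N) (Fin N) ℂ := (g : Matrix (Fin N) (Fin N) ℂ) with hQ
  -- the five smooth cores
  have h1 := (contDiff_reTrCubic (N := N) B Δ B).add (contDiff_reTrCubic (N := N) B B Δ)
  have h3' := (contDiff_imTrMul_sub (N := N) B m₁).mul (contDiff_imTrQuad (N := N) Δ B)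
  have h4 := contDiff_quad_etaShift (N := N) κt c B B Δ m₂
  have h5 := contDiff_quad_etaShift (N := N) κt c Δ B B m₁
  have h8 := contDiff_imShift_mul_imProd (N := N) B Δ m₁
  have hG : (fun Q : Matrix (Fin N) (Fin N) ℂ =>
      κw / 2 *
          ((Q * B * Q * Δ * Q * B).trace.re + (Q * B * Q * B * Q * Δ).trace.re)
        + 2 * κw / N * ((Q * B).trace - m₁).im * (Q * Δ * Q * B).trace.im
        - 1 / 2 * ((Q * B * Q * B).trace *
            ((κt : ℂ) * ((Q * Δ).trace - m₂)
              - (c : ℂ) * (starRingEnd ℂ) ((Q * Δ).trace - m₂))).re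
        - 1 / 2 * ((Q * Δ * Q * B).trace *
            ((κt : ℂ) * ((Q * B).trace - m₁)
              - (c : ℂ) * (starRingEnd ℂ) ((Q * B).trace - m₁))).re
        - 2 * κt / N *
          ((Q * B).trace - m₁).im * ((Q * B).trace * (Q * Δ).trace).im) =
      fun Q : Matrix (Fin N) (Fin N) ℂ =>
        (κw / 2) * ((Q * B * Q * Δ * Q * B).trace.re + (Q * B * Q * B * Q * Δ).trace.re)
        + (2 * κw / N) * (((Q * B).trace - m₁).im * (Q * Δ * Q * B).trace.im)
        + (-(1 / 2)) * ((Q * B * Q * B).trace * ((κt : ℂ) * ((Q * Δ).trace - m₂) - (c : ℂ) * (starRingEnd ℂ) ((Q * Δ).trace - m₂))).re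
        + (-(1 / 2)) * ((Q * Δ * Q * B).trace * ((κt : ℂ) * ((Q * B).trace - m₁) - (c : ℂ) * (starRingEnd ℂ) ((Q * B).trace - m₁))).re
        + (-(2 * κt / N)) * (((Q * B).trace - m₁).im * ((Q * B).trace * (Q * Δ).trace).im) := by
    funext Q; ring
  have g1 : ContDiff ℝ ∞ fun Q : Matrix (Fin N) (Fin N) ℂ =>
      (κw / 2) * ((Q * B * Q * Δ * Q * B).trace.re + (Q * B * Q * B * Q * Δ).trace.re) := contDiff_const.mul h1
  have g3 : ContDiff ℝ ∞ fun Q : Matrix (Fin N) (Fin N) ℂ =>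
      (2 * κw / N) * (((Q * B).trace - m₁).im * (Q * Δ * Q * B).trace.im) := contDiff_const.mul h3'
  have g4 : ContDiff ℝ ∞ fun Q : Matrix (Fin N) (Fin N) ℂ => (-(1 / 2)) *
      ((Q * B * Q * B).trace * ((κt : ℂ) * ((Q * Δ).trace - m₂) - (c : ℂ) * (starRingEnd ℂ) ((Q * Δ).trace - m₂))).re := contDiff_const.mul h4
  have g5 : ContDiff ℝ ∞ fun Q : Matrix (Fin N) (Fin N) ℂ => (-(1 / 2)) *
      ((Q * Δ * Q * B).trace * ((κt : ℂ) * ((Q * B).trace - m₁) - (c : ℂ) * (starRingEnd ℂ) ((Q * B).trace - m₁))).re := contDiff_const.mul h5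
  have g8 : ContDiff ℝ ∞ fun Q : Matrix (Fin N) (Fin N) ℂ =>
      (-(2 * κt / N)) * (((Q * B).trace - m₁).im * ((Q * B).trace * (Q * Δ).trace).im) := contDiff_const.mul h8
  have s3 := g1.add g3
  have s4 := s3.add g4
  have s5 := s4.add g5
  rw [hG, matD_fun_add s5 g8, matD_fun_add s4 g5, matD_fun_add s3 g4, matD_fun_add g1 g3]
  simp only []
  rw [matD_const_mul h1, matD_const_mul h3', matD_const_mul h4, matD_const_mul h5, matD_const_mul h8]
  simp only []
  -- the five term bounds
  have hA := frobNorm_nonneg A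
  have hB0 := matrixOpNorm_nonneg B
  have hBF := frobNorm_nonneg B
  have hΔ := frobNorm_nonneg Δ
  have e1 : |matD A (fun Q : Matrix (Fin N) (Fin N) ℂ =>
      (Q * B * Q * Δ * Q * B).trace.re + (Q * B * Q * B * Q * Δ).trace.re) Q| ≤
      6 * matrixOpNorm B ^ 2 * frobNorm Δ * frobNorm A := by
    rw [matD_fun_add (contDiff_reTrCubic B Δ B) (contDiff_reTrCubic B B Δ)]
    have t1 := abs_matD_reTrCubic_BDB_le A B Δ g
    have t2 := abs_matD_reTrCubic_BBD_le A B Δ g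
    refine (abs_add_le _ _).trans ?_
    rw [← hQ] at t1 t2
    linarith
  have e3 := abs_matD_imShift_mul_imQuad_le A B Δ m₁ g
  have e4 : |matD A (fun Q : Matrix (Fin N) (Fin N) ℂ =>
      ((Q * B * Q * B).trace * ((κt : ℂ) * ((Q * Δ).trace - m₂) - (c : ℂ) * (starRingEnd ℂ) ((Q * Δ).trace - m₂))).re) Q| ≤
      (κt + c) * (2 * matrixOpNorm B * frobNorm B * ‖(Q * Δ).trace - m₂‖ + ‖(Q * B * Q * B).trace‖ * frobNorm Δ) * frobNorm A := by
    refine (abs_matD_quad_etaShift_le hκt0 hc0 A B B Δ m₂ g).trans ?_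
    rw [← hQ]
    have hb := frobNorm_BgM_le B B g
    rw [← hQ] at hb
    have hκc : 0 ≤ κt + c := add_nonneg hκt0 hc0
    have : (frobNorm (B * Q * B) + frobNorm (B * Q * B)) * ‖(Q * Δ).trace - m₂‖ ≤
        2 * matrixOpNorm B * frobNorm B * ‖(Q * Δ).trace - m₂‖ := by nlinarith [norm_nonneg ((Q * Δ).trace - m₂)]
    exact mul_le_mul_of_nonneg_right (mul_le_mul_of_nonneg_left (by linarith) hκc) hA
  have e5 : |matD A (fun Q : Matrix (Fin N) (Fin N) ℂ =>
      ((Q * Δ * Q * B).trace * ((κt : ℂ) * ((Q * B).trace - m₁) - (c : ℂ) * (starRingEnd ℂ) ((Q * B).trace - m₁))).re) Q| ≤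
      (κt + c) * (2 * matrixOpNorm B * frobNorm Δ * ‖(Q * B).trace - m₁‖ + ‖(Q * Δ * Q * B).trace‖ * frobNorm B) * frobNorm A := by
    refine (abs_matD_quad_etaShift_le hκt0 hc0 A Δ B B m₁ g).trans ?_
    rw [← hQ]
    have hb1 := frobNorm_MgB_le Δ B g
    have hb2 := frobNorm_BgM_le B Δ g
    rw [← hQ] at hb1 hb2
    have hκc : 0 ≤ κt + c := add_nonneg hκt0 hc0
    have : (frobNorm (Δ * Q * B) + frobNorm (B * Q * Δ)) * ‖(Q * B).trace - m₁‖ ≤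
        2 * matrixOpNorm B * frobNorm Δ * ‖(Q * B).trace - m₁‖ := by nlinarith [norm_nonneg ((Q * B).trace - m₁)]
    exact mul_le_mul_of_nonneg_right (mul_le_mul_of_nonneg_left (by linarith) hκc) hA
  have e8 := abs_matD_imShift_mul_imProd_le A B Δ m₁ g
  rw [← hQ] at e3 e8
  -- assemble
  have X0 := abs_nonneg ((Q * B).trace - m₁).im
  have z1m := norm_nonneg ((Q * B).trace - m₁)
  have z2m := norm_nonneg ((Q * Δ).trace - m₂)
  have z10 := norm_nonneg (Q * B).trace
  have z20 := norm_nonneg (Q * Δ).trace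
  have w0 := norm_nonneg (Q * Δ * Q * B).trace
  have wBB0 := norm_nonneg (Q * B * Q * B).trace
  calc _ ≤ |κw / 2 * matD A (fun Q : Matrix (Fin N) (Fin N) ℂ =>
              (Q * B * Q * Δ * Q * B).trace.re + (Q * B * Q * B * Q * Δ).trace.re) Q|
          + |2 * κw / N * matD A (fun Q : Matrix (Fin N) (Fin N) ℂ => ((Q * B).trace - m₁).im * (Q * Δ * Q * B).trace.im) Q|
          + |(-(1 / 2)) * matD A (fun Q : Matrix (Fin N) (Fin N) ℂ =>
              ((Q * B * Q * B).trace * ((κt : ℂ) * ((Q * Δ).trace - m₂) - (c : ℂ) * (starRingEnd ℂ) ((Q * Δ).trace - m₂))).re) Q|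
          + |(-(1 / 2)) * matD A (fun Q : Matrix (Fin N) (Fin N) ℂ =>
              ((Q * Δ * Q * B).trace * ((κt : ℂ) * ((Q * B).trace - m₁) - (c : ℂ) * (starRingEnd ℂ) ((Q * B).trace - m₁))).re) Q|
          + |(-(2 * κt / N)) * matD A (fun Q : Matrix (Fin N) (Fin N) ℂ =>
              ((Q * B).trace - m₁).im * ((Q * B).trace * (Q * Δ).trace).im) Q| := by
        refine (abs_add_le _ _).trans ?_
        gcongr
        refine (abs_add_le _ _).trans ?_
        gcongr
        refine (abs_add_le _ _).trans ?_
        gcongr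
        exact abs_add_le _ _
    _ = κw / 2 * |matD A (fun Q : Matrix (Fin N) (Fin N) ℂ =>
              (Q * B * Q * Δ * Q * B).trace.re + (Q * B * Q * B * Q * Δ).trace.re) Q|
          + 2 * κw / N * |matD A (fun Q : Matrix (Fin N) (Fin N) ℂ => ((Q * B).trace - m₁).im * (Q * Δ * Q * B).trace.im) Q|
          + 1 / 2 * |matD A (fun Q : Matrix (Fin N) (Fin N) ℂ =>
              ((Q * B * Q * B).trace * ((κt : ℂ) * ((Q * Δ).trace - m₂) - (c : ℂ) * (starRingEnd ℂ) ((Q * Δ).trace - m₂))).re) Q|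
          + 1 / 2 * |matD A (fun Q : Matrix (Fin N) (Fin N) ℂ =>
              ((Q * Δ * Q * B).trace * ((κt : ℂ) * ((Q * B).trace - m₁) - (c : ℂ) * (starRingEnd ℂ) ((Q * B).trace - m₁))).re) Q|
          + 2 * κt / N * |matD A (fun Q : Matrix (Fin N) (Fin N) ℂ =>
              ((Q * B).trace - m₁).im * ((Q * B).trace * (Q * Δ).trace).im) Q| := by
        simp only [abs_mul, abs_neg, abs_of_nonneg (by positivity : (0 : ℝ) ≤ κw / 2),
          abs_of_nonneg (by positivity : (0 : ℝ) ≤ 2 * κw / N), abs_of_nonneg (by norm_num : (0 : ℝ) ≤ 1 / 2),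
          abs_of_nonneg (by positivity : (0 : ℝ) ≤ 2 * κt / N)]
    _ ≤ κw / 2 * (6 * matrixOpNorm B ^ 2 * frobNorm Δ * frobNorm A)
          + 2 * κw / N * ((2 * matrixOpNorm B * frobNorm Δ * |((Q * B).trace - m₁).im|
              + frobNorm B * ‖(Q * Δ * Q * B).trace‖) * frobNorm A)
          + 1 / 2 * ((κt + c) * (2 * matrixOpNorm B * frobNorm B * ‖(Q * Δ).trace - m₂‖ + ‖(Q * B * Q * B).trace‖ * frobNorm Δ)
              * frobNorm A)
          + 1 / 2 * ((κt + c) * (2 * matrixOpNorm B * frobNorm Δ * ‖(Q * B).trace - m₁‖ + ‖(Q * Δ * Q * B).trace‖ * frobNorm B)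
              * frobNorm A)
          + 2 * κt / N * ((|((Q * B).trace - m₁).im| * (frobNorm B * ‖(Q * Δ).trace‖ + frobNorm Δ * ‖(Q * B).trace‖)
              + frobNorm B * ‖(Q * B).trace‖ * ‖(Q * Δ).trace‖) * frobNorm A) := by
        gcongr
    _ = _ := by simp only [hc]; ring

/-- **`Γ(ĉ₃', ĉ₃')(g) ≤ P̂'(g)²` on `SU(N)`** for the RECENTRED five-term non-linear part of the cubic remainder, `N ≥ 3`:
the tree's `Gam_c3prime_le` with `‖tr(gB)‖ ↦ ‖tr(gB) − m₁‖`, `|Im tr(gB)| ↦ |Im(tr(gB) − m₁)|`, `‖tr(gΔ)‖ ↦ ‖tr(gΔ) − m₂‖` in the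
slots that come from the `η`-factors (the slots coming from the WORDS `t = tr(gB)tr(gΔ)`, `w`, `w_BB` are unchanged). [folklore] -/
theorem Gam_c3hat_le (hN : 3 ≤ N) (B Δ : Matrix (Fin N) (Fin N) ℂ) (m₁ m₂ : ℂ) (g : SUN N) :
    Gam (fun Q : Matrix (Fin N) (Fin N) ℂ =>
      ((N : ℝ) ^ 2 / (4 * ((N : ℝ) ^ 2 - 4))) / 2 *
          ((Q * B * Q * Δ * Q * B).trace.re + (Q * B * Q * B * Q * Δ).trace.re)
        + 2 * ((N : ℝ) ^ 2 / (4 * ((N : ℝ) ^ 2 - 4))) / N * ((Q * B).trace - m₁).im * (Q * Δ * Q * B).trace.im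
        - 1 / 2 * ((Q * B * Q * B).trace *
            ((((N : ℝ) / (2 * ((N : ℝ) ^ 2 - 4)) : ℝ) : ℂ) * ((Q * Δ).trace - m₂)
              - ((1 / (4 * (N : ℝ)) : ℝ) : ℂ) * (starRingEnd ℂ) ((Q * Δ).trace - m₂))).re
        - 1 / 2 * ((Q * Δ * Q * B).trace *
            ((((N : ℝ) / (2 * ((N : ℝ) ^ 2 - 4)) : ℝ) : ℂ) * ((Q * B).trace - m₁)
              - ((1 / (4 * (N : ℝ)) : ℝ) : ℂ) * (starRingEnd ℂ) ((Q * B).trace - m₁))).re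
        - 2 * ((N : ℝ) / (2 * ((N : ℝ) ^ 2 - 4))) / N *
          ((Q * B).trace - m₁).im * ((Q * B).trace * (Q * Δ).trace).im)
      (fun Q : Matrix (Fin N) (Fin N) ℂ =>
      ((N : ℝ) ^ 2 / (4 * ((N : ℝ) ^ 2 - 4))) / 2 *
          ((Q * B * Q * Δ * Q * B).trace.re + (Q * B * Q * B * Q * Δ).trace.re)
        + 2 * ((N : ℝ) ^ 2 / (4 * ((N : ℝ) ^ 2 - 4))) / N * ((Q * B).trace - m₁).im * (Q * Δ * Q * B).trace.im
        - 1 / 2 * ((Q * B * Q * B).trace *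
            ((((N : ℝ) / (2 * ((N : ℝ) ^ 2 - 4)) : ℝ) : ℂ) * ((Q * Δ).trace - m₂)
              - ((1 / (4 * (N : ℝ)) : ℝ) : ℂ) * (starRingEnd ℂ) ((Q * Δ).trace - m₂))).re
        - 1 / 2 * ((Q * Δ * Q * B).trace *
            ((((N : ℝ) / (2 * ((N : ℝ) ^ 2 - 4)) : ℝ) : ℂ) * ((Q * B).trace - m₁)
              - ((1 / (4 * (N : ℝ)) : ℝ) : ℂ) * (starRingEnd ℂ) ((Q * B).trace - m₁))).re
        - 2 * ((N : ℝ) / (2 * ((N : ℝ) ^ 2 - 4))) / N *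
          ((Q * B).trace - m₁).im * ((Q * B).trace * (Q * Δ).trace).im) g ≤
      (3 * ((N : ℝ) ^ 2 / (4 * ((N : ℝ) ^ 2 - 4))) * matrixOpNorm B ^ 2 * frobNorm Δ
        + 2 * ((N : ℝ) ^ 2 / (4 * ((N : ℝ) ^ 2 - 4))) / N *
          (2 * matrixOpNorm B * frobNorm Δ * |(((g : Matrix (Fin N) (Fin N) ℂ) * B).trace - m₁).im|
            + frobNorm B * ‖((g : Matrix (Fin N) (Fin N) ℂ) * Δ * g * B).trace‖)
        + 1 / 2 * (((N : ℝ) / (2 * ((N : ℝ) ^ 2 - 4))) + 1 / (4 * (N : ℝ))) *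
          (2 * matrixOpNorm B * frobNorm B * ‖((g : Matrix (Fin N) (Fin N) ℂ) * Δ).trace - m₂‖
            + frobNorm Δ * ‖((g : Matrix (Fin N) (Fin N) ℂ) * B * g * B).trace‖)
        + 1 / 2 * (((N : ℝ) / (2 * ((N : ℝ) ^ 2 - 4))) + 1 / (4 * (N : ℝ))) *
          (2 * matrixOpNorm B * frobNorm Δ * ‖((g : Matrix (Fin N) (Fin N) ℂ) * B).trace - m₁‖
            + frobNorm B * ‖((g : Matrix (Fin N) (Fin N) ℂ) * Δ * g * B).trace‖)
        + 2 * ((N : ℝ) / (2 * ((N : ℝ) ^ 2 - 4))) / N *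
          (frobNorm B * |(((g : Matrix (Fin N) (Fin N) ℂ) * B).trace - m₁).im| * ‖((g : Matrix (Fin N) (Fin N) ℂ) * Δ).trace‖
            + frobNorm Δ * |(((g : Matrix (Fin N) (Fin N) ℂ) * B).trace - m₁).im| * ‖((g : Matrix (Fin N) (Fin N) ℂ) * B).trace‖
            + frobNorm B * ‖((g : Matrix (Fin N) (Fin N) ℂ) * B).trace‖ * ‖((g : Matrix (Fin N) (Fin N) ℂ) * Δ).trace‖)) ^ 2 := by
  have hN0 : N ≠ 0 := by omega
  rw [Gam_self_eq_sum_sq]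
  exact sum_sq_apply_frame_le hN0 (dirFun _ _) fun A => abs_matD_c3hat_le hN B Δ A m₁ m₂ g


end Calc

end Summit.Ventures.YMGap.OneLinkEigen
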